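import Summits.AtomisticToContinuum.FouriersLaw.Theorems.OddSectorIrreversibilityWitnessGlueLeak
import Literature.MathematicalPhysics.KineticTheory.ChainReflection

/-!
# `WitnessGlue` (stmt-AtomisticToContinuum-14072) — support 7: the response bound at one chain length

Support file for `OddSectorIrreversibility.WitnessGlue`: `response_bound` — from the dictionary
form of the route's hypotheses at one `N ≥ 16` (the corrector with clauses A(1), A(2), A(5), A(6),
A(7); the Green–Kubo pairing `⟨u, J⟩_{μ_T} = Z (N-1) T² D`; the symmetry of the two tap norms; `E1`,
`E2` at this `N`; the cone bound `E3`) the response coefficient satisfies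
`0 ≤ D ≤ 2K₁/T² + c²/T⁴` with `K₁ = 64 √(C₁C₂(1+a))/a`, `c = 64 a γ T √(2TC₃/γ)/κ²`, uniformly in
`N` (one central block `[N/4, N-1-N/4)`, one window `τ = a (N/4)/2`). No route statement is asserted.
-/

noncomputable section

namespace Summit.AtomisticToContinuum.FouriersLaw.Theorems.OddSectorWitness

open MeasureTheory Filter Topology ProbabilityTheory Set
open scoped NNReal ENNReal
open Literature.MathematicalPhysics.KineticTheory.HeatConduction
open Summit.AtomisticToContinuum.FouriersLaw.Theorems.ClosedConeSensitivity.Negative.ZeroFrictionDictionary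

variable {ω₂ lam β : ℝ} (hω : 0 < ω₂) (hl : 0 ≤ lam) (hβ : 0 ≤ β)
include hω hl hβ

/-! ## The response bound at one (large) chain length -/

section Core

variable (γ : ℝ) (N : ℕ) {T : ℝ}

omit hω hl hβ in
/-- `q² e^{-κ q/4} ≤ 32/κ²` (`x²/2 ≤ eˣ`). [folklore] -/
theorem sq_mul_exp_neg_le {κ : ℝ} (hκ : 0 < κ) (q : ℝ) (hq : 0 ≤ q) :
    q ^ 2 * Real.exp (-(κ * q / 4)) ≤ 32 / κ ^ 2 := by
  have h := Real.pow_div_factorial_le_exp (x := κ * q / 4) (by positivity) 2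
  simp only [Nat.factorial_two, Nat.cast_ofNat] at h
  have hexp : 0 < Real.exp (κ * q / 4) := Real.exp_pos _
  rw [Real.exp_neg, ← div_eq_mul_inv, div_le_div_iff₀ hexp (by positivity)]
  nlinarith [h, hκ]

/-- **Bond sum rule ⇒ every interior bond pairs with `u` like `⟨u, J⟩/(N-1)`.** [folklore] -/
theorem integral_mul_bondCurrent_eq_of_sumRule (hT : 0 < T) {u : PhaseSpace N → ℝ}
    (hu2 : MemLp u 2 (gibbsWeight ω₂ lam β γ N T))
    (h5 : ∀ i i' : Fin N, i'.val = i.val + 1 → i'.val + 1 < N →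
      ∫ x, u x * (pinnedChain ω₂ lam β γ).bondCurrent N i x ∂(gibbsWeight ω₂ lam β γ N T) =
        ∫ x, u x * (pinnedChain ω₂ lam β γ).bondCurrent N i' x ∂(gibbsWeight ω₂ lam β γ N T))
    {S : ℝ} (hJ : ∫ x, u x * (∑ i : Fin N, (pinnedChain ω₂ lam β γ).bondCurrent N i x) ∂(gibbsWeight ω₂ lam β γ N T) =
      ((N : ℝ) - 1) * S)
    (i : Fin N) (hi : i.val + 1 < N) :
    ∫ x, u x * (pinnedChain ω₂ lam β γ).bondCurrent N i x ∂(gibbsWeight ω₂ lam β γ N T) = S := by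
  set P := pinnedChain ω₂ lam β γ
  set μ := gibbsWeight ω₂ lam β γ N T
  have hN : 2 ≤ N := by have := i.isLt; omega
  let F : Fin N → ℝ := fun i => ∫ x, u x * P.bondCurrent N i x ∂μ
  -- all interior bonds agree with bond `0`
  have hconst : ∀ m : ℕ, ∀ hm : m + 1 < N, F ⟨m, by omega⟩ = F ⟨0, by omega⟩ := by
    intro m
    induction m with
    | zero => intro _; rfl
    | succ m ih =>
        intro hm
        rw [← ih (by omega)]
        exact (h5 ⟨m, by omega⟩ ⟨m + 1, by omega⟩ rfl hm).symm
  -- the last bond carries no current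
  have hlast : F ⟨N - 1, by omega⟩ = 0 := by
    show ∫ x, u x * P.bondCurrent N ⟨N - 1, by omega⟩ x ∂μ = 0
    have : ∀ x, P.bondCurrent N ⟨N - 1, by omega⟩ x = 0 := fun x =>
      P.bondCurrent_eq_zero_of_last N _ (by simp; omega) x
    simp [this]
  -- sum over all bonds
  have hsum : ∫ x, u x * (∑ i : Fin N, P.bondCurrent N i x) ∂μ = ∑ i : Fin N, F i := by
    simp_rw [Finset.mul_sum]
    rw [integral_finsetSum]
    intro i _
    exact hu2.integrable_mul (memLp_bondCurrent hω hl hβ γ N hT i)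
  have hsplit : ∑ i : Fin N, F i = ((N : ℝ) - 1) * F ⟨0, by omega⟩ := by
    have hF : ∀ j : Fin N, F j = if j.val + 1 < N then F ⟨0, by omega⟩ else 0 := by
      intro j
      split_ifs with h
      · have := hconst j.val h
        simpa using this
      · have hj : j = ⟨N - 1, by omega⟩ := Fin.ext (by simp; omega)
        rw [hj]; exact hlast
    rw [Finset.sum_congr rfl (fun j _ => hF j), Finset.sum_ite, Finset.sum_const_zero, add_zero,
      Finset.sum_const, nsmul_eq_mul]
    have hc : (Finset.univ.filter (fun j : Fin N => j.val + 1 < N)) =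
        Finset.univ.filter (fun j : Fin N => 0 ≤ j.val ∧ j.val < N - 1) := by
      ext j; simp; omega
    rw [hc, card_block N (by omega : N - 1 ≤ N), Nat.sub_zero, Nat.cast_sub (by omega : 1 ≤ N), Nat.cast_one]
  have h0 : F ⟨0, by omega⟩ = S := by
    have h := hJ
    rw [hsum, hsplit] at h
    have hN1 : ((N : ℝ) - 1) ≠ 0 := by
      have : (2 : ℝ) ≤ N := by exact_mod_cast hN
      linarith
    exact mul_left_cancel₀ hN1 h
  rw [← h0, ← hconst i.val hi]

omit hω hl hβ in
/-- Final arithmetic: `T² D ≤ K₁ + c √D` with `D ≥ 0` gives `D ≤ 2K₁/T² + c²/T⁴`. [folklore] -/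
theorem le_of_sq_le_add_sqrt {T D K₁ c : ℝ} (hT : 0 < T) (hD : 0 ≤ D)
    (h : T ^ 2 * D ≤ K₁ + c * Real.sqrt D) : D ≤ 2 * K₁ / T ^ 2 + c ^ 2 / T ^ 4 := by
  have hs := Real.sq_sqrt hD
  have hs0 := Real.sqrt_nonneg D
  have hT2 : 0 < T ^ 2 := by positivity
  have hT4 : 0 < T ^ 4 := by positivity
  have key : T ^ 2 * D ≤ 2 * K₁ + c ^ 2 / T ^ 2 := by
    have : c * Real.sqrt D ≤ c ^ 2 / (2 * T ^ 2) + T ^ 2 * D / 2 := by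
      rw [div_add_div _ _ (by positivity) (by positivity), le_div_iff₀ (by positivity)]
      nlinarith [sq_nonneg (c - T ^ 2 * Real.sqrt D), hs, hs0]
    have h2 : c ^ 2 / (2 * T ^ 2) = (c ^ 2 / T ^ 2) / 2 := by field_simp
    nlinarith [this, h, h2]
  rw [div_add_div _ _ hT2.ne' hT4.ne', le_div_iff₀ (by positivity)]
  have e1 : c ^ 2 / T ^ 2 * (T ^ 2 * T ^ 4) = c ^ 2 * T ^ 4 := by field_simp
  nlinarith [key, e1, hT2, hT4, mul_le_mul_of_nonneg_right key hT4.le]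

/-- **The response bound at one chain length `N ≥ 16`** from the dictionary form of the route's
hypotheses at that `N`: the corrector `u` (clauses A(1), A(2), A(5), A(6), A(7) of `CorrectorTheory`,
the latter two read through the zero-friction dictionary), the Green–Kubo pairing
`⟨u, J⟩_{μ_T} = Z (N-1) T² D` (clause B with A(4)), the symmetry of the two tap norms (reflection),
the bounds `E1` and `E2` at this `N`, and the cone bound `E3`. The bound is uniform in `N`. [folklore] -/
theorem response_bound (hT : 0 < T) (hγ : 0 < γ)
    {a κ C₁ C₂ C₃ : ℝ} (ha : 0 < a) (hκ : 0 < κ) (hC₁ : 0 ≤ C₁) (hC₂ : 0 ≤ C₂) (hC₃ : 0 ≤ C₃)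
    (hcone : ConeBoundAt ω₂ lam β γ T a κ C₃)
    (hN : 16 ≤ N) {D : ℝ}
    {u : PhaseSpace N → ℝ} (hu1 : ContDiff ℝ 1 u) (hu2 : MemLp u 2 (gibbsWeight ω₂ lam β γ N T))
    (h5 : ∀ i i' : Fin N, i'.val = i.val + 1 → i'.val + 1 < N →
      ∫ x, u x * (pinnedChain ω₂ lam β γ).bondCurrent N i x ∂(gibbsWeight ω₂ lam β γ N T) =
        ∫ x, u x * (pinnedChain ω₂ lam β γ).bondCurrent N i' x ∂(gibbsWeight ω₂ lam β γ N T))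
    (b₀ b₁ : Fin N) (hb₀ : b₀.val = 0) (hb₁ : b₁.val = N - 1)
    (h6 : γ * T * ((∫ x, (partialP b₀ u x) ^ 2 ∂(gibbsWeight ω₂ lam β γ N T)) +
        ∫ x, (partialP b₁ u x) ^ 2 ∂(gibbsWeight ω₂ lam β γ N T)) =
      ∫ x, u x * (∑ i : Fin N, (pinnedChain ω₂ lam β γ).bondCurrent N i x) ∂(gibbsWeight ω₂ lam β γ N T))
    (hsym : Integrable (fun x => (partialP b₀ u x) ^ 2) (gibbsWeight ω₂ lam β γ N T) ↔
      Integrable (fun x => (partialP b₁ u x) ^ 2) (gibbsWeight ω₂ lam β γ N T))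
    (jt : Fin N → ℝ → PhaseSpace N → ℝ)
    (hjt : ∀ i s x, jt i s x = (pinnedChain ω₂ lam β γ).bondCurrent N i (detFlow ω₂ lam β N ((s.toNNReal : ℝ≥0) : ℝ) x))
    (hA7 : ∀ (i : Fin N) (t : ℝ), 0 ≤ t →
      (∫ x, (u x - u (x.1, -x.2)) / 2 * jt i t x ∂(gibbsWeight ω₂ lam β γ N T)) -
        (∫ x, (u x - u (x.1, -x.2)) / 2 * (pinnedChain ω₂ lam β γ).bondCurrent N i x ∂(gibbsWeight ω₂ lam β γ N T)) =
      -(γ * T) * ∫ s in Ioc (0 : ℝ) t,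
        ((∫ x, partialP b₀ (fun y : PhaseSpace N => (u y + u (y.1, -y.2)) / 2) x * partialP b₀ (jt i s) x
            ∂(gibbsWeight ω₂ lam β γ N T)) +
          ∫ x, partialP b₁ (fun y : PhaseSpace N => (u y + u (y.1, -y.2)) / 2) x * partialP b₁ (jt i s) x
            ∂(gibbsWeight ω₂ lam β γ N T)))
    (hGK : ∫ x, u x * (∑ i : Fin N, (pinnedChain ω₂ lam β γ).bondCurrent N i x) ∂(gibbsWeight ω₂ lam β γ N T) =
      (∫ x, Real.exp (-((pinnedChain ω₂ lam β γ).hamiltonian N x) / T) ∂volume) * (((N : ℝ) - 1) * T ^ 2 * D))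
    (hE1 : ∫ x, (u x) ^ 2 ∂(gibbsWeight ω₂ lam β γ N T) ≤
      C₁ * (N : ℝ) ^ 2 * ∫ x, Real.exp (-((pinnedChain ω₂ lam β γ).hamiltonian N x) / T) ∂volume)
    (hE2 : ∀ k₁ k₂ : ℕ, k₁ ≤ k₂ → k₂ + 1 ≤ N → ∀ τ : ℝ, 0 ≤ τ →
      ∫ x, (window ω₂ lam β γ N k₁ k₂ τ x) ^ 2 ∂(gibbsWeight ω₂ lam β γ N T) ≤
        C₂ * (1 + τ) * ((k₂ : ℝ) - k₁) * ∫ x, Real.exp (-((pinnedChain ω₂ lam β γ).hamiltonian N x) / T) ∂volume) :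
    0 ≤ D ∧ D ≤ 2 * (64 * Real.sqrt (C₁ * C₂ * (1 + a)) / a) / T ^ 2 +
      (64 * a * γ * T * Real.sqrt (2 * T * C₃ / γ) / κ ^ 2) ^ 2 / T ^ 4 := by
  set P := pinnedChain ω₂ lam β γ
  set μ := gibbsWeight ω₂ lam β γ N T
  set Z : ℝ := ∫ x, Real.exp (-(P.hamiltonian N x) / T) ∂volume with hZdef
  set K₁ : ℝ := 64 * Real.sqrt (C₁ * C₂ * (1 + a)) / a with hK₁
  set c₄ : ℝ := 64 * a * γ * T * Real.sqrt (2 * T * C₃ / γ) / κ ^ 2 with hc₄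
  have hZ : 0 < Z := integral_exp_pos (pinnedChain_integrable_gibbsDensity hω hl hβ γ N hT)
  have hN2 : (2 : ℝ) ≤ N := by exact_mod_cast (show 2 ≤ N by omega)
  have hN1 : 0 < (N : ℝ) - 1 := by linarith
  have hK₁0 : 0 ≤ K₁ := by positivity
  have hc₄0 : 0 ≤ c₄ := by positivity
  -- Step A: `D ≥ 0` from the tap identity
  have hΛ'0 : 0 ≤ (∫ x, (partialP b₀ u x) ^ 2 ∂μ) + ∫ x, (partialP b₁ u x) ^ 2 ∂μ :=
    add_nonneg (integral_nonneg fun _ => sq_nonneg _) (integral_nonneg fun _ => sq_nonneg _)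
  have hGK' : γ * T * ((∫ x, (partialP b₀ u x) ^ 2 ∂μ) + ∫ x, (partialP b₁ u x) ^ 2 ∂μ) =
      Z * (((N : ℝ) - 1) * T ^ 2 * D) := h6.trans hGK
  have hD0 : 0 ≤ D := by
    have h1 : 0 ≤ Z * (((N : ℝ) - 1) * T ^ 2 * D) := by
      rw [← hGK']; exact mul_nonneg (mul_nonneg hγ.le hT.le) hΛ'0
    have h2 : 0 < Z * (((N : ℝ) - 1) * T ^ 2) := by positivity
    rw [show Z * (((N : ℝ) - 1) * T ^ 2 * D) = (Z * (((N : ℝ) - 1) * T ^ 2)) * D by ring] at h1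
    exact nonneg_of_mul_nonneg_right h1 h2
  refine ⟨hD0, ?_⟩
  -- Step B: the junk case (both tap norms infinite) gives `D = 0`
  by_cases hint : Integrable (fun x => (partialP b₀ u x) ^ 2) μ
  swap
  · have hint1 : ¬ Integrable (fun x => (partialP b₁ u x) ^ 2) μ := fun h => hint (hsym.2 h)
    rw [integral_undef hint, integral_undef hint1, add_zero, mul_zero] at hGK'
    have : D = 0 := by
      have h2 : 0 < Z * (((N : ℝ) - 1) * T ^ 2) := by positivity
      have h3 : Z * (((N : ℝ) - 1) * T ^ 2) * D = 0 := by rw [mul_assoc, ← hGK']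
      rcases mul_eq_zero.1 h3 with h | h
      · exact absurd h h2.ne'
      · exact h
    rw [this]; positivity
  -- Main case
  have hint1 : Integrable (fun x => (partialP b₁ u x) ^ 2) μ := hsym.1 hint
  have hcont : Continuous u := hu1.continuous
  have hQ₀ : MemLp (partialP b₀ u) 2 μ :=
    (memLp_two_iff_integrable_sq (measurable_partialP N hcont b₀).aestronglyMeasurable).2 hint
  have hQ₁ : MemLp (partialP b₁ u) 2 μ :=
    (memLp_two_iff_integrable_sq (measurable_partialP N hcont b₁).aestronglyMeasurable).2 hint1
  set Λ : ℝ := (∫ x, (partialP b₀ u x) ^ 2 ∂μ) + ∫ x, (partialP b₁ u x) ^ 2 ∂μ with hΛdef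
  have hΛ : Λ = Z * ((N : ℝ) - 1) * T * D / γ := by
    rw [eq_div_iff hγ.ne']
    apply mul_left_cancel₀ hT.ne'
    linear_combination hGK'
  -- the block, the window, the static pairing
  set q : ℕ := N / 4 with hq
  have hq4 : 4 * q ≤ N := Nat.mul_div_le N 4
  have hqlt : N < 4 * q + 4 := by omega
  have hq1 : 4 ≤ q := by omega
  set k₂ : ℕ := N - 1 - q with hk₂def
  have hk : q ≤ k₂ := by omega
  have hk₂ : k₂ + 1 ≤ N := by omega
  set τ : ℝ := a * q / 2 with hτ
  have hτ0 : 0 < τ := by positivity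
  set s : ℝ := Z * T ^ 2 * D with hs
  have hS : ∀ i : Fin N, q ≤ i.val → i.val < k₂ → ∫ x, u x * P.bondCurrent N i x ∂μ = s := by
    intro i _ hi2
    refine integral_mul_bondCurrent_eq_of_sumRule hω hl hβ γ N hT hu2 h5 ?_ i (by omega)
    rw [hGK]; ring
  set L : ℝ := γ * T * (Real.sqrt (2 * Λ * C₃ * Z) * Real.exp (-(κ * q / 4))) with hL
  have hL0 : 0 ≤ L := by positivity
  have hLeak : ∀ i : Fin N, q ≤ i.val → i.val < k₂ → ∀ t : ℝ, 0 < t → t ≤ τ →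
      ∫ x, (u x - u (x.1, -x.2)) / 2 * P.bondCurrent N i x ∂μ - L * t ≤
        ∫ x, (u x - u (x.1, -x.2)) / 2 * P.bondCurrent N i (detFlow ω₂ lam β N t x) ∂μ := by
    intro i hi1 hi2 t ht htτ
    exact leak_bound hω hl hβ γ N hT hγ.le ha hκ hC₃ hcone hu1 b₀ b₁ hb₀ hb₁ hQ₀ hQ₁ i hi1 (by omega)
      (jt i) (hjt i) (hA7 i) ht htτ
  have hW := witness_inequality hω hl hβ γ N hT hu2 hk (by omega) hτ0.le hS hLeak
  -- real-arithmetic facts about the block and the window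
  set Br : ℝ := (k₂ : ℝ) - q with hBrdef
  have hqr4 : (4 : ℝ) ≤ q := by exact_mod_cast hq1
  have hq4r : 4 * (q : ℝ) ≤ N := by exact_mod_cast hq4
  have hqN : (N : ℝ) ≤ 8 * q := by
    have : (N : ℝ) < 4 * q + 4 := by exact_mod_cast hqlt
    linarith
  have hBr_eq : Br = (N : ℝ) - 1 - 2 * q := by
    rw [hBrdef, hk₂def, Nat.cast_sub (by omega), Nat.cast_sub (by omega), Nat.cast_one]
    ring
  have hN16 : (16 : ℝ) ≤ N := by exact_mod_cast hN
  have hBr : (N : ℝ) / 4 ≤ Br := by rw [hBr_eq]; linarith only [hq4r, hN16]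
  have hBr' : Br ≤ N := by rw [hBr_eq]; linarith only [hqr4]
  have hBr0 : 0 < Br := by linarith only [hBr, hN2]
  have hτN : τ ≤ a * N := by
    rw [hτ, show a * (q : ℝ) / 2 = a * (q / 2) by ring]
    exact mul_le_mul_of_nonneg_left (by linarith only [hq4r, hqr4]) ha.le
  have hBrτ : a * (N : ℝ) ^ 2 / 64 ≤ Br * τ := by
    rw [hτ]
    have : a * (N : ℝ) ^ 2 / 64 ≤ ((N : ℝ) / 4) * (a * q / 2) := by
      rw [show a * (N : ℝ) ^ 2 / 64 = (a * N / 8) * (N / 8) by ring,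
        show ((N : ℝ) / 4) * (a * q / 2) = (a * N / 8) * q by ring]
      exact mul_le_mul_of_nonneg_left (by linarith only [hqN]) (by positivity)
    exact this.trans (mul_le_mul_of_nonneg_right hBr (by positivity))
  -- `E1`, `E2` ⇒ the Cauchy–Schwarz right-hand side is `≤ Z N² √(C₁C₂(1+a))`
  set K : ℝ := C₁ * C₂ * (1 + a) with hKdef
  have hK0 : 0 ≤ K := by positivity
  have hE2' := hE2 q k₂ hk hk₂ τ hτ0.le
  have hR : Real.sqrt (∫ x, (u x) ^ 2 ∂μ) * Real.sqrt (∫ x, (window ω₂ lam β γ N q k₂ τ x) ^ 2 ∂μ) ≤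
      Z * (N : ℝ) ^ 2 * Real.sqrt K := by
    have h1 := Real.sqrt_le_sqrt hE1
    have h2 := Real.sqrt_le_sqrt hE2'
    have h12 := mul_le_mul h1 h2 (Real.sqrt_nonneg _) (Real.sqrt_nonneg _)
    refine h12.trans ?_
    rw [← Real.sqrt_mul (by positivity)]
    have hprod : (1 + τ) * Br ≤ (1 + a) * (N : ℝ) ^ 2 := by
      have h1N : (1 : ℝ) ≤ N := by linarith only [hN2]
      have : 1 + τ ≤ (1 + a) * N := by
        rw [show (1 + a) * (N : ℝ) = N + a * N by ring]; linarith only [hτN, h1N]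
      calc (1 + τ) * Br ≤ ((1 + a) * N) * N := mul_le_mul this hBr' hBr0.le (by positivity)
        _ = (1 + a) * (N : ℝ) ^ 2 := by ring
    have hle : C₁ * (N : ℝ) ^ 2 * Z * (C₂ * (1 + τ) * Br * Z) ≤ (Z * (N : ℝ) ^ 2 * Real.sqrt K) ^ 2 := by
      calc C₁ * (N : ℝ) ^ 2 * Z * (C₂ * (1 + τ) * Br * Z) = (C₁ * C₂ * Z ^ 2 * (N : ℝ) ^ 2) * ((1 + τ) * Br) := by ring
        _ ≤ (C₁ * C₂ * Z ^ 2 * (N : ℝ) ^ 2) * ((1 + a) * (N : ℝ) ^ 2) :=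
            mul_le_mul_of_nonneg_left hprod (by positivity)
        _ = (Z * (N : ℝ) ^ 2 * Real.sqrt K) ^ 2 := by
            rw [mul_pow, mul_pow, Real.sq_sqrt hK0, hKdef]; ring
    calc Real.sqrt (C₁ * (N : ℝ) ^ 2 * Z * (C₂ * (1 + τ) * Br * Z)) ≤ Real.sqrt ((Z * (N : ℝ) ^ 2 * Real.sqrt K) ^ 2) :=
          Real.sqrt_le_sqrt hle
      _ = Z * (N : ℝ) ^ 2 * Real.sqrt K := Real.sqrt_sq (by positivity)
  -- the leak rate in terms of `D`
  set L' : ℝ := γ * T * Z * Real.sqrt (2 * T * C₃ / γ) * N * Real.sqrt D * Real.exp (-(κ * q / 4)) with hL'def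
  have hLL' : L ≤ L' := by
    rw [hL, hL'def]
    have h1 : Real.sqrt (2 * Λ * C₃ * Z) = Z * Real.sqrt (2 * ((N : ℝ) - 1) * T * D * C₃ / γ) := by
      rw [hΛ, show 2 * (Z * ((N : ℝ) - 1) * T * D / γ) * C₃ * Z = Z ^ 2 * (2 * ((N : ℝ) - 1) * T * D * C₃ / γ) by ring,
        Real.sqrt_mul (sq_nonneg _), Real.sqrt_sq hZ.le]
    have h2 : Real.sqrt (2 * ((N : ℝ) - 1) * T * D * C₃ / γ) ≤ Real.sqrt (2 * T * C₃ / γ) * (N * Real.sqrt D) := by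
      rw [show 2 * ((N : ℝ) - 1) * T * D * C₃ / γ = (2 * T * C₃ / γ) * (((N : ℝ) - 1) * D) by ring,
        Real.sqrt_mul (by positivity)]
      refine mul_le_mul_of_nonneg_left ?_ (Real.sqrt_nonneg _)
      rw [show (N : ℝ) * Real.sqrt D = Real.sqrt ((N : ℝ) ^ 2 * D) by
        rw [Real.sqrt_mul (sq_nonneg _), Real.sqrt_sq (by positivity)]]
      refine Real.sqrt_le_sqrt (mul_le_mul_of_nonneg_right ?_ hD0)
      nlinarith only [hN2]
    rw [h1]
    have h3 : 0 ≤ γ * T * Z := by positivity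
    have h4 : 0 ≤ Real.exp (-(κ * q / 4)) := (Real.exp_pos _).le
    calc γ * T * (Z * Real.sqrt (2 * ((N : ℝ) - 1) * T * D * C₃ / γ) * Real.exp (-(κ * q / 4)))
        = (γ * T * Z) * Real.sqrt (2 * ((N : ℝ) - 1) * T * D * C₃ / γ) * Real.exp (-(κ * q / 4)) := by ring
      _ ≤ (γ * T * Z) * (Real.sqrt (2 * T * C₃ / γ) * (N * Real.sqrt D)) * Real.exp (-(κ * q / 4)) := by
          gcongr
      _ = _ := by ring
  -- (I): the witness inequality with `E1`, `E2` and `L ≤ L'`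
  have hI : Br * Z * τ * (T ^ 2 * D) ≤ Z * (N : ℝ) ^ 2 * Real.sqrt K + Br * τ ^ 2 / 2 * L' := by
    have h1 : Br * (s * τ - L * τ ^ 2 / 2) ≤ Z * (N : ℝ) ^ 2 * Real.sqrt K := hW.trans hR
    have h2 : Br * τ ^ 2 / 2 * L ≤ Br * τ ^ 2 / 2 * L' := mul_le_mul_of_nonneg_left hLL' (by positivity)
    rw [hs] at h1
    linarith only [h1, h2]
  -- (II): the two comparison facts
  have hA : Z * (N : ℝ) ^ 2 * Real.sqrt K ≤ Br * Z * τ * K₁ := by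
    rw [hK₁]
    have : (N : ℝ) ^ 2 ≤ Br * τ * (64 / a) := by
      rw [mul_div_assoc', le_div_iff₀ ha]; linarith only [hBrτ]
    calc Z * (N : ℝ) ^ 2 * Real.sqrt K ≤ Z * (Br * τ * (64 / a)) * Real.sqrt K := by gcongr
      _ = Br * Z * τ * (64 * Real.sqrt K / a) := by ring
  have hB : Br * τ ^ 2 / 2 * L' ≤ Br * Z * τ * (c₄ * Real.sqrt D) := by
    rw [hL'def, hc₄, hτ]
    have hqe : (q : ℝ) * N * Real.exp (-(κ * q / 4)) ≤ 256 / κ ^ 2 := by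
      have h1 := sq_mul_exp_neg_le hκ (q : ℝ) (by positivity)
      have h2 : (q : ℝ) * N * Real.exp (-(κ * q / 4)) ≤ 8 * ((q : ℝ) ^ 2 * Real.exp (-(κ * q / 4))) := by
        have he := (Real.exp_pos (-(κ * q / 4))).le
        calc (q : ℝ) * N * Real.exp (-(κ * q / 4)) = ((q : ℝ) * Real.exp (-(κ * q / 4))) * N := by ring
          _ ≤ ((q : ℝ) * Real.exp (-(κ * q / 4))) * (8 * q) := mul_le_mul_of_nonneg_left hqN (by positivity)
          _ = 8 * ((q : ℝ) ^ 2 * Real.exp (-(κ * q / 4))) := by ring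
      calc (q : ℝ) * N * Real.exp (-(κ * q / 4)) ≤ 8 * ((q : ℝ) ^ 2 * Real.exp (-(κ * q / 4))) := h2
        _ ≤ 8 * (32 / κ ^ 2) := mul_le_mul_of_nonneg_left h1 (by norm_num)
        _ = 256 / κ ^ 2 := by ring
    have hF : 0 ≤ γ * T * Z * Real.sqrt (2 * T * C₃ / γ) * Real.sqrt D := by positivity
    have hκ2 : 0 < κ ^ 2 := by positivity
    -- both sides are (common nonneg factor) × (scalar); compare scalars
    have key : (a * q / 2) ^ 2 / 2 * (N * Real.exp (-(κ * q / 4))) ≤ (a * q / 2) * (64 * a / κ ^ 2) := by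
      rw [show (a * q / 2) ^ 2 / 2 * (N * Real.exp (-(κ * q / 4))) = (a * q / 2) * ((a / 4) * (q * N * Real.exp (-(κ * q / 4)))) by ring]
      refine mul_le_mul_of_nonneg_left ?_ (by positivity)
      rw [show 64 * a / κ ^ 2 = (a / 4) * (256 / κ ^ 2) by ring]
      exact mul_le_mul_of_nonneg_left hqe (by positivity)
    calc Br * (a * ↑q / 2) ^ 2 / 2 * (γ * T * Z * Real.sqrt (2 * T * C₃ / γ) * ↑N * Real.sqrt D * Real.exp (-(κ * ↑q / 4)))
        = (Br * (γ * T * Z * Real.sqrt (2 * T * C₃ / γ) * Real.sqrt D)) *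
            ((a * q / 2) ^ 2 / 2 * (N * Real.exp (-(κ * q / 4)))) := by ring
      _ ≤ (Br * (γ * T * Z * Real.sqrt (2 * T * C₃ / γ) * Real.sqrt D)) * ((a * q / 2) * (64 * a / κ ^ 2)) :=
          mul_le_mul_of_nonneg_left key (mul_nonneg hBr0.le hF)
      _ = Br * Z * (a * ↑q / 2) * (64 * a * γ * T * Real.sqrt (2 * T * C₃ / γ) / κ ^ 2 * Real.sqrt D) := by
          field_simp
  -- (III): conclude
  have hmain : T ^ 2 * D ≤ K₁ + c₄ * Real.sqrt D := by
    have hpos : 0 < Br * Z * τ := by positivity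
    have : Br * Z * τ * (T ^ 2 * D) ≤ Br * Z * τ * (K₁ + c₄ * Real.sqrt D) := by linarith only [hI, hA, hB]
    exact le_of_mul_le_mul_left this hpos
  exact le_of_sq_le_add_sqrt hT hD0 hmain

end Core

end Summit.AtomisticToContinuum.FouriersLaw.Theorems.OddSectorWitness
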